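import Summits.AtomisticToContinuum.Crystallization.Theses.PalmUnimodularRigidity
import Summits.AtomisticToContinuum.Crystallization.Theorems.MinimiserShells.Negative.LoadBearing
import Summits.AtomisticToContinuum.Crystallization.Theorems.MinimiserShells.Negative.Rootedness
import Literature.Probability.Process.PointStationaryLaw
import Literature.MathematicalPhysics.StatisticalMechanics.RootEnergy
import Literature.MathematicalPhysics.StatisticalMechanics.MuGSC

/-!
# Countable reduction of Sütő's `μ`GSC test (Lennard-Jones, uniformly discrete sets)

Helper file for stub `stub_equilibriumInLaw` (S1, the lever) of line `equilibrium-in-law-surgery`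
of crux `MinimiserShells` (stmt-AtomisticToContinuum-9225), step "(iv) countably many rules
suffice" of the sparse-surgery proof.

`IsMuGSC lennardJones μ X` (Sütő 2006) quantifies over ALL finite modifications "remove the
`n` distinct points `xf` of `X`, insert `k` distinct points `R` off `X ∖ range xf`".  For a
uniformly discrete `X ⊆ ℝ³` it suffices to test insertions `R` with all coordinates in a fixed
DENSE set `Q` (e.g. the rational points): `isMuGSC_of_dense`.  Reason: for fixed `xf`, the
right-hand side `R ↦ U(R) + I(R, X ∖ X_f) − μ k` of the defining inequality is CONTINUOUS at every
admissible `R` (injective, off `Y := X ∖ X_f`) — `V_LJ` is continuous on `(0, ∞)`, each `R i` is at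
positive distance from the closed discrete set `Y` and from the other `R j`, and the field sum
`∑_{y ∈ Y} V_LJ(|q − y|)` converges uniformly for `q` near `R i` by the `r⁻⁶` tail (Tannery /
dominated convergence for `tsum`, dominating function from
`UniformlyDiscrete.summable_of_abs_le_inv_pow_six`) — while the admissible set is OPEN, so `R`
is a limit of admissible `Q`-valued configurations and the inequality passes to the limit
(`ge_of_tendsto`).  With `X` countable (separated sets are countable, `countable_of_separated`)
and `Q` countable this leaves countably many tests, which is what the Mecke localisation of the
surgery argument can afford.

Contents: `isClosed_of_uniformlyDiscrete`, `exists_pos_le_dist` (positive gap off a uniformly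
discrete set), `abs_lennardJones_le_of_le` (`|V_LJ| ≤ ε⁻¹²/12 + ε⁻⁶/6` on `[ε, ∞)`),
`continuousAt_tsum_lennardJones` (the LJ field of a uniformly discrete set is continuous off the
set), `continuousAt_fieldEnergy`, `continuousAt_interactionEnergy`, `isOpen_setOf_admissible`,
`mem_closure_admissible_inter_pi`, and the reduction `isMuGSC_of_dense`.
-/

noncomputable section

open MeasureTheory
open scoped ENNReal BigOperators

namespace Summit.AtomisticToContinuum.Crystallization.Theorems.PalmUnimodularRigidityMinimiserShells.EquilibriumInLaw.Countable

open Literature.Probability.Process (IsPointStationaryLaw IsRootedHardCore count_restrict_singleton_ne_zero_iff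
  map_sub_count_restrict)
open Literature.MathematicalPhysics.StatisticalMechanics (lennardJones IsMuGSC UniformlyDiscrete)
open Summit.AtomisticToContinuum.Crystallization.Theses.PalmUnimodularRigidity (MinimiserShells UnimodularEnergyLowerBound)
open Summit.AtomisticToContinuum.Crystallization.Theorems.MinimiserShells.Negative.LoadBearing
  (eStar meanRootEnergy GoodShell minimiserShells_iff)
open Literature.MathematicalPhysics.StatisticalMechanics (interactionEnergy fieldEnergy
  continuousOn_lennardJones abs_lennardJones_le)
open Summit.AtomisticToContinuum.Crystallization.Theorems.MinimiserShells.Negative.Rootedness (E3)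
open Filter Topology

/-! ## Uniformly discrete sets: closedness and the gap off the set -/

/-- A uniformly discrete set is closed (distinct points are `≥ δ > 0` apart;
`Metric.isClosed_of_pairwise_le_dist`). -/
theorem isClosed_of_uniformlyDiscrete {X : Set E3} (hX : UniformlyDiscrete X) : IsClosed X := by
  obtain ⟨δ, hδ, hsep⟩ := hX
  exact Metric.isClosed_of_pairwise_le_dist hδ fun x hx y hy hxy => hsep x hx y hy hxy

/-- A point off a uniformly discrete set is at distance `≥ ε` from all of its points, for some
`ε > 0`. -/
theorem exists_pos_le_dist {X : Set E3} (hX : UniformlyDiscrete X) {p : E3} (hp : p ∉ X) :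
    ∃ ε : ℝ, 0 < ε ∧ ∀ y ∈ X, ε ≤ dist p y := by
  obtain ⟨ε, hε, hball⟩ :=
    Metric.isOpen_iff.1 (isClosed_of_uniformlyDiscrete hX).isOpen_compl p hp
  refine ⟨ε, hε, fun y hy => ?_⟩
  by_contra hlt
  exact hball (Metric.mem_ball'.2 (not_le.1 hlt)) hy

/-! ## Lennard-Jones bounds and continuity of the field off a uniformly discrete set -/

/-- `|V_LJ(t)| ≤ ε⁻¹² / 12 + ε⁻⁶ / 6` for `t ≥ ε > 0`. -/
theorem abs_lennardJones_le_of_le {ε t : ℝ} (hε : 0 < ε) (ht : ε ≤ t) :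
    |lennardJones t| ≤ 1 / 12 * ε⁻¹ ^ 12 + 1 / 6 * ε⁻¹ ^ 6 := by
  have h0 : 0 ≤ t⁻¹ := inv_nonneg.2 (hε.le.trans ht)
  have h1 : t⁻¹ ≤ ε⁻¹ := inv_anti₀ hε ht
  have h6 : t⁻¹ ^ 6 ≤ ε⁻¹ ^ 6 := pow_le_pow_left₀ h0 h1 6
  have h12 : t⁻¹ ^ 12 ≤ ε⁻¹ ^ 12 := pow_le_pow_left₀ h0 h1 12
  have h6' : 0 ≤ t⁻¹ ^ 6 := pow_nonneg h0 6
  have h12' : 0 ≤ t⁻¹ ^ 12 := pow_nonneg h0 12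
  unfold lennardJones
  rw [abs_le]
  constructor <;> linarith

/-- **The Lennard-Jones field of a uniformly discrete set is continuous off the set**: for
`Y ⊆ ℝ³` uniformly discrete and `p ∉ Y`, `q ↦ ∑_{y ∈ Y} V_LJ(|q − y|)` is continuous at `p`
(Tannery's theorem: if `|p − y| ≥ ε` on `Y`, then for `q ∈ B(p, ε/2)` every term
`V_LJ(|q − y|)` is dominated by `W(|p − y|)`, `W(t) = (ε/2)⁻¹²/12 + (ε/2)⁻⁶/6` for
`t < T = max(1 + ε/2, ε)` and `16 t⁻⁶` beyond, and `W(|p − ·|)` is summable over `Y` by the `r⁻⁶`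
shell bound `UniformlyDiscrete.summable_of_abs_le_inv_pow_six`). -/
theorem continuousAt_tsum_lennardJones {Y : Set E3} (hY : UniformlyDiscrete Y) {p : E3}
    (hp : p ∉ Y) : ContinuousAt (fun q : E3 => ∑' y : Y, lennardJones (dist q y)) p := by
  obtain ⟨ε, hε, hfar⟩ := exists_pos_le_dist hY hp
  set T : ℝ := max (1 + ε / 2) ε with hT
  set B : ℝ := 1 / 12 * (ε / 2)⁻¹ ^ 12 + 1 / 6 * (ε / 2)⁻¹ ^ 6 with hB
  set W : ℝ → ℝ := fun t => if t < T then B else 16 * t⁻¹ ^ 6 with hW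
  have hT0 : 0 < T := lt_of_lt_of_le (by linarith) (le_max_left _ _)
  have hsum : Summable fun y : Y => W (dist p y) := by
    refine hY.summable_of_abs_le_inv_pow_six (C := 16) hT0 (fun t ht => ?_) p
    simp only [hW, if_neg (not_lt.2 ht)]
    rw [abs_of_nonneg (by positivity)]
  change Tendsto (fun q : E3 => ∑' y : Y, lennardJones (dist q y)) (𝓝 p)
    (𝓝 (∑' y : Y, lennardJones (dist p y)))
  refine tendsto_tsum_of_dominated_convergence hsum (fun y => ?_) ?_
  · have hy0 : dist p (y : E3) ≠ 0 := (hε.trans_le (hfar y y.2)).ne'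
    have h1 : ContinuousAt lennardJones (dist p (y : E3)) :=
      continuousOn_lennardJones.continuousAt (isOpen_compl_singleton.mem_nhds hy0)
    exact h1.tendsto.comp ((continuous_id.dist continuous_const).tendsto p)
  · filter_upwards [Metric.ball_mem_nhds p (half_pos hε)] with q hq y
    rw [Real.norm_eq_abs]
    have hpq : dist q p < ε / 2 := Metric.mem_ball.1 hq
    have hpy : ε ≤ dist p y := hfar y y.2
    have htri : dist p y ≤ dist p q + dist q y := dist_triangle p q y
    rw [dist_comm p q] at htri
    by_cases hlt : dist p (y : E3) < T
    · simp only [hW, if_pos hlt]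
      exact abs_lennardJones_le_of_le (half_pos hε) (by linarith)
    · simp only [hW, if_neg hlt]
      rw [not_lt] at hlt
      have h1 : 1 + ε / 2 ≤ dist p y := (le_max_left _ _).trans hlt
      have ht1 : 1 ≤ dist q y := by linarith
      have ht2 : dist p y / 2 ≤ dist q y := by linarith
      have hi : (dist q (y : E3))⁻¹ ≤ (dist p y / 2)⁻¹ := inv_anti₀ (by linarith) ht2
      have hi6 := pow_le_pow_left₀ (inv_nonneg.2 dist_nonneg) hi 6
      calc |lennardJones (dist q y)| ≤ 1 / 4 * (dist q (y : E3))⁻¹ ^ 6 := abs_lennardJones_le ht1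
        _ ≤ 1 / 4 * (dist p y / 2)⁻¹ ^ 6 := by linarith
        _ = 16 * (dist p (y : E3))⁻¹ ^ 6 := by rw [inv_div]; ring

/-- Continuity of `R ↦ I(R, Y)` (`fieldEnergy`) at every configuration `R` off the uniformly
discrete set `Y`. -/
theorem continuousAt_fieldEnergy {Y : Set E3} (hY : UniformlyDiscrete Y) {k : ℕ}
    {R : Fin k → E3} (hR : Disjoint (Set.range R) Y) :
    ContinuousAt (fun R' : Fin k → E3 => fieldEnergy lennardJones R' Y) R := by
  unfold fieldEnergy
  refine tendsto_finsetSum _ fun i _ => ?_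
  have hi : R i ∉ Y := fun h => Set.disjoint_left.1 hR (Set.mem_range_self i) h
  exact (continuousAt_tsum_lennardJones hY hi).tendsto.comp ((continuous_apply i).tendsto R)

/-- Continuity of `R ↦ U(R)` (`interactionEnergy lennardJones`) at every injective `R`. -/
theorem continuousAt_interactionEnergy {k : ℕ} {R : Fin k → E3} (hR : Function.Injective R) :
    ContinuousAt (fun R' : Fin k → E3 => interactionEnergy lennardJones R') R := by
  unfold interactionEnergy
  refine tendsto_finsetSum _ fun i _ => tendsto_finsetSum _ fun j hj => ?_
  have h0 : dist (R i) (R j) ≠ 0 := dist_ne_zero.2 (hR.ne (Finset.mem_Ioi.1 hj).ne)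
  have h1 : ContinuousAt lennardJones (dist (R i) (R j)) :=
    continuousOn_lennardJones.continuousAt (isOpen_compl_singleton.mem_nhds h0)
  exact h1.tendsto.comp (((continuous_apply i).dist (continuous_apply j)).tendsto R)

/-! ## The admissible insertions form an open set; dense coordinates approximate them -/

/-- The admissible insertions — injective `R` off the closed set `Y` — form an open subset of
`(Fin k → ℝ³)`. -/
theorem isOpen_setOf_admissible {Y : Set E3} (hY : IsClosed Y) (k : ℕ) :
    IsOpen {R : Fin k → E3 | Function.Injective R ∧ Disjoint (Set.range R) Y} := by
  have h1 : IsOpen {R : Fin k → E3 | Function.Injective R} := by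
    have hrepr : {R : Fin k → E3 | Function.Injective R} =
        ⋂ i : Fin k, ⋂ j : Fin k, {R | i = j ∨ R i ≠ R j} := by
      ext R
      simp only [Set.mem_setOf_eq, Set.mem_iInter]
      constructor
      · intro h i j
        exact (eq_or_ne i j).imp_right fun hij => h.ne hij
      · intro h i j hij
        exact ((h i j).resolve_right fun hne => hne hij)
    rw [hrepr]
    refine isOpen_iInter_of_finite fun i => isOpen_iInter_of_finite fun j => ?_
    by_cases hij : i = j
    · have : {R : Fin k → E3 | i = j ∨ R i ≠ R j} = Set.univ :=
        Set.eq_univ_of_forall fun _ => Or.inl hij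
      rw [this]
      exact isOpen_univ
    · have : {R : Fin k → E3 | i = j ∨ R i ≠ R j} = {R | R i ≠ R j} := by
        ext R
        simp [hij]
      rw [this]
      exact isOpen_ne_fun (continuous_apply i) (continuous_apply j)
  have h2 : IsOpen {R : Fin k → E3 | Disjoint (Set.range R) Y} := by
    have hrepr : {R : Fin k → E3 | Disjoint (Set.range R) Y} = ⋂ i, {R | R i ∈ Yᶜ} := by
      ext R
      simp only [Set.mem_setOf_eq, Set.mem_iInter, Set.mem_compl_iff, Set.disjoint_left,
        Set.mem_range, forall_exists_index, forall_apply_eq_imp_iff]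
    rw [hrepr]
    exact isOpen_iInter_of_finite fun i => hY.isOpen_compl.preimage (continuous_apply i)
  exact h1.inter h2

/-- Every admissible insertion `R` (injective, off the closed set `Y`) is a limit of admissible
insertions with all points in a given dense set `Q`. -/
theorem mem_closure_admissible_inter_pi {Y : Set E3} (hY : IsClosed Y) {Q : Set E3}
    (hQ : Dense Q) {k : ℕ} {R : Fin k → E3} (hR : Function.Injective R)
    (hdisj : Disjoint (Set.range R) Y) :
    R ∈ closure ({R' : Fin k → E3 | Function.Injective R' ∧ Disjoint (Set.range R') Y} ∩
      Set.pi Set.univ fun _ => Q) := by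
  have hA := isOpen_setOf_admissible hY k
  have hQk : Dense (Set.pi Set.univ fun _ : Fin k => Q) := dense_pi Set.univ fun _ _ => hQ
  rw [mem_closure_iff_nhds]
  intro t ht
  obtain ⟨U, hU, hUo, hRU⟩ := mem_nhds_iff.1 (inter_mem ht (hA.mem_nhds ⟨hR, hdisj⟩))
  obtain ⟨R', hR'U, hR'Q⟩ := hQk.inter_open_nonempty U hUo ⟨R, hRU⟩
  exact ⟨R', (hU hR'U).1, (hU hR'U).2, hR'Q⟩

/-! ## The reduction -/

/-- **Countable reduction of Sütő's `μ`GSC test.**  Let `X ⊆ ℝ³` be uniformly discrete and `Q`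
dense in `ℝ³`.  If the defining inequality of `IsMuGSC lennardJones μ X` — no finite modification
"remove the distinct points `xf` of `X`, insert distinct points `R` off `X ∖ range xf`" lowers
`U + I − μ·#` — holds for all removals `xf` and all insertions `R` WITH POINTS IN `Q`, then `X`
is a `μ`GSC of Lennard-Jones (summability of the fields being automatic,
`UniformlyDiscrete.summable_lennardJones`).  With `Q` countable (rational points) and `X`
countable these are countably many conditions. -/
theorem isMuGSC_of_dense {X : Set E3} (hX : UniformlyDiscrete X) {Q : Set E3} (hQ : Dense Q)
    {μ : ℝ}
    (h : ∀ (n : ℕ) (xf : Fin n → E3), Function.Injective xf → Set.range xf ⊆ X →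
      ∀ (k : ℕ) (R : Fin k → E3), (∀ i, R i ∈ Q) → Function.Injective R →
        Disjoint (Set.range R) (X \ Set.range xf) →
          interactionEnergy lennardJones xf + fieldEnergy lennardJones xf (X \ Set.range xf) -
              μ * n ≤
            interactionEnergy lennardJones R + fieldEnergy lennardJones R (X \ Set.range xf) -
              μ * k) :
    IsMuGSC lennardJones μ X := by
  refine ⟨hX.summable_lennardJones, fun n xf hxf hxX k R hR hdisj => ?_⟩
  set Y : Set E3 := X \ Set.range xf with hY
  have hYud : UniformlyDiscrete Y := hX.mono fun x hx => hx.1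
  set A : Set (Fin k → E3) := {R' | Function.Injective R' ∧ Disjoint (Set.range R') Y} with hA
  set Qk : Set (Fin k → E3) := Set.pi Set.univ fun _ => Q with hQk
  haveI : (𝓝[A ∩ Qk] R).NeBot := mem_closure_iff_nhdsWithin_neBot.1
    (mem_closure_admissible_inter_pi (isClosed_of_uniformlyDiscrete hYud) hQ hR hdisj)
  set F : (Fin k → E3) → ℝ := fun R' =>
    interactionEnergy lennardJones R' + fieldEnergy lennardJones R' Y - μ * k with hF
  have hFc : ContinuousAt F R :=
    ((continuousAt_interactionEnergy hR).add (continuousAt_fieldEnergy hYud hdisj)).sub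
      continuousAt_const
  have hlim : Tendsto F (𝓝[A ∩ Qk] R) (𝓝 (F R)) := hFc.continuousWithinAt
  refine ge_of_tendsto hlim (eventually_nhdsWithin_of_forall ?_)
  rintro R' ⟨⟨hR'inj, hR'disj⟩, hR'Q⟩
  exact h n xf hxf hxX k R' (fun i => hR'Q i (Set.mem_univ i)) hR'inj hR'disj

/-- Registered stub marker (helper part 1/14 of `stub_equilibriumInLaw`, line `equilibrium-in-law-surgery`):
the countable reduction `isMuGSC_of_dense` in closed form. -/
theorem stub_equilibriumInLaw_part01 :
    ∀ (X Q : Set (EuclideanSpace ℝ (Fin 3))) (μ : ℝ), UniformlyDiscrete X → Dense Q →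
      (∀ (n : ℕ) (xf : Fin n → EuclideanSpace ℝ (Fin 3)), Function.Injective xf → Set.range xf ⊆ X →
        ∀ (k : ℕ) (R : Fin k → EuclideanSpace ℝ (Fin 3)), (∀ i, R i ∈ Q) → Function.Injective R →
          Disjoint (Set.range R) (X \ Set.range xf) →
            interactionEnergy lennardJones xf + fieldEnergy lennardJones xf (X \ Set.range xf) - μ * n ≤
              interactionEnergy lennardJones R + fieldEnergy lennardJones R (X \ Set.range xf) - μ * k) →
      IsMuGSC lennardJones μ X :=
  fun _ _ _ hX hQ h => isMuGSC_of_dense hX hQ h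

end Summit.AtomisticToContinuum.Crystallization.Theorems.PalmUnimodularRigidityMinimiserShells.EquilibriumInLaw.Countable

end
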